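import Summits.FinalStateConjecture.FinalStateConjecture.Theorems.SwallowTheDatumKerrShieldedSettlesStubCollarCauchyAux
import Summits.FinalStateConjecture.FinalStateConjecture.Theorems.SwallowTheDatumUniversalWitnessFamilyRegionOneHoleChart
import Summits.FinalStateConjecture.FinalStateConjecture.Theorems.EIHFluxBalanceInertialRecessionLorentz
import Summits.FinalStateConjecture.FinalStateConjecture.Theorems.KerrShieldedDataExist.Negative.BentHeightSmooth
import Literature.Geometry.Lorentzian.KerrConvergenceProofs
import Mathlib.Analysis.SpecialFunctions.SmoothTransition
import Mathlib.Analysis.InnerProductSpace.Calculus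
import Mathlib.Analysis.Calculus.ContDiff.Bounds

/-!
# Route EIHFluxBalance — `ModulatedKerrHandoff`, line `swallow-transfer`: the bent lab chart's cutoff (part 1)

Helper file for the crux `stmt-FinalStateConjecture-10167`
(`Summit.FinalStateConjecture.FinalStateConjecture.Theses.EIHFluxBalance.ModulatedKerrHandoff`), stub
`stub_bentLabDeviation` of the line `swallow-transfer`.

The bent lab chart is the Kerr–Schild time translation `f(x) = x + Θ(x) e₀` by
`Θ(x) = χ₁(|x̲|/x⁰ − 1) · T(|x̲|)`, `χ₁ = Real.smoothTransition`, `T = bentHeight M a`,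
`|x̲| = E4.spatialNorm x`. This file treats the two factors separately:

* the CUTOFF `p(x) = χ₁(|x̲|/x⁰ − 1)`: it is smooth on the half-space `{x⁰ > 0}`, homogeneous of
  degree `0` under positive dilations, identically `1` on `{|x̲| > 2x⁰}` and identically `0` on
  `{|x̲| < x⁰}`; by scaling and compactness of `{x⁰ = 1, |x̲| ≤ 2}` all its derivatives of order
  `i ≤ 4` are bounded by `A / (x⁰)ⁱ` (`bentLabDeviation_cutoff_bounds`, the registered sub-goal of this file);
* the RADIAL HEIGHT `x ↦ T(|x̲|)`: smooth on all of `E4` (`T ≡ 0` below `4M`), nonnegative, and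
  `≤ 2M log(|x̲|/M)` for `|x̲| ≥ M`.

All statements are elementary calculus. [folklore]
-/

-- `Summit.FinalStateConjecture.FinalStateConjecture.…` is the summit's mandated namespace (summit = problem name)
set_option linter.dupNamespace false

noncomputable section

open Set Filter Topology Function
open scoped ContDiff Topology
open Literature.Geometry.Lorentzian
open Summit.FinalStateConjecture.FinalStateConjecture.Theorems.KerrShieldedDataExist.Negative
  (bentHeight blHeight bentHeight_eq_zero_of_le mass_pos contDiff_bentHeight)
open Summit.FinalStateConjecture.FinalStateConjecture.Theorems.KerrShieldedSettles.Negative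
  (bentHeight_le_two_mul_log)
open Summit.FinalStateConjecture.FinalStateConjecture.Theorems.SwallowTheDatum.UniversalWitnessFamily
  (contDiffAt_spatialNorm contDiff_apply_zero)
open Summit.FinalStateConjecture.FinalStateConjecture.Theorems.SwallowTheDatum.KerrShieldedSettles.CollarCauchy
  (bentHeight_nonneg)

namespace Summit.FinalStateConjecture.FinalStateConjecture.Theorems.BentLabDeviation

/-! ### Small facts on `E4` -/

/-- The time coordinate `x ↦ x⁰` is continuous. [folklore] -/
theorem continuous_apply_zero : Continuous fun x : E4 ↦ x 0 := PiLp.continuous_apply 2 _ 0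

/-- The spatial radius is continuous. [folklore] -/
theorem continuous_spatialNorm : Continuous E4.spatialNorm :=
  continuous_norm.comp E4.spatial.continuous

/-- Time coordinate of a dilate: `(c x)⁰ = c x⁰`. [folklore] -/
theorem smul_apply_zero (c : ℝ) (x : E4) : (c • x) 0 = c * x 0 := by
  simp

/-- A positive time coordinate stays positive nearby. [folklore] -/
theorem eventually_pos_apply_zero {y : E4} (hy : 0 < y 0) : ∀ᶠ z in 𝓝 y, 0 < z 0 :=
  continuousAt_const.eventually_lt continuous_apply_zero.continuousAt hy

/-! ### The cutoff `p(x) = χ₁(|x̲|/x⁰ − 1)` -/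

/-- **Dilation invariance of the cutoff**: `p(c x) = p(x)` for `c > 0`. [folklore] -/
theorem cutoff_smul {c : ℝ} (hc : 0 < c) (y : E4) :
    Real.smoothTransition (E4.spatialNorm (c • y) / (c • y) 0 - 1) =
      Real.smoothTransition (E4.spatialNorm y / y 0 - 1) := by
  rw [Kerr.spatialNorm_smul, abs_of_pos hc, smul_apply_zero, mul_div_mul_left _ _ hc.ne']

/-- **The cutoff is smooth on the half-space `{x⁰ > 0}`** (off the time axis it is a composition
of smooth maps; on the time axis it vanishes identically nearby). [folklore] -/
theorem contDiffAt_cutoff {y : E4} (hy : 0 < y 0) {n : ℕ∞} :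
    ContDiffAt ℝ n (fun z : E4 ↦ Real.smoothTransition (E4.spatialNorm z / z 0 - 1)) y := by
  by_cases h0 : E4.spatialNorm y = 0
  · have hc : ContinuousAt (fun z : E4 ↦ E4.spatialNorm z / z 0) y :=
      (continuous_spatialNorm.continuousAt).div continuous_apply_zero.continuousAt hy.ne'
    have hval : (fun z : E4 ↦ E4.spatialNorm z / z 0) y < (fun _ : E4 ↦ (1 : ℝ)) y := by
      show E4.spatialNorm y / y 0 < 1
      rw [h0, zero_div]
      exact one_pos
    have hlt : ∀ᶠ z in 𝓝 y, E4.spatialNorm z / z 0 < 1 := hc.eventually_lt continuousAt_const hval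
    have hev : (fun z : E4 ↦ Real.smoothTransition (E4.spatialNorm z / z 0 - 1)) =ᶠ[𝓝 y]
        fun _ ↦ (0 : ℝ) := by
      filter_upwards [hlt] with z hz
      exact Real.smoothTransition.zero_of_nonpos (by linarith)
    exact (contDiffAt_const (c := (0 : ℝ))).congr_of_eventuallyEq hev
  · have h1 : ContDiffAt ℝ n E4.spatialNorm y := contDiffAt_spatialNorm h0
    have h2 : ContDiffAt ℝ n (fun z : E4 ↦ z 0) y := contDiff_apply_zero.contDiffAt
    exact Real.smoothTransition.contDiff.contDiffAt.comp y ((h1.div h2 hy.ne').sub contDiffAt_const)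

/-- Far from the axis (`|x̲| > 2x⁰ > 0`) the cutoff is identically `1` near the point. [folklore] -/
theorem cutoff_eventuallyEq_one {y : E4} (hy : 0 < y 0) (hfar : 2 * y 0 < E4.spatialNorm y) :
    (fun z : E4 ↦ Real.smoothTransition (E4.spatialNorm z / z 0 - 1)) =ᶠ[𝓝 y]
      fun _ ↦ (1 : ℝ) := by
  have h2 : ∀ᶠ z in 𝓝 y, 2 * z 0 < E4.spatialNorm z :=
    (continuous_const.mul continuous_apply_zero).continuousAt.eventually_lt
      continuous_spatialNorm.continuousAt hfar
  filter_upwards [eventually_pos_apply_zero hy, h2] with z hz hz2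
  apply Real.smoothTransition.one_of_one_le
  rw [le_sub_iff_add_le, le_div_iff₀ hz]
  linarith

/-- Inside the cone (`|x̲| < x⁰`) the cutoff is identically `0` near the point. [folklore] -/
theorem cutoff_eventuallyEq_zero {y : E4} (hy : 0 < y 0) (hin : E4.spatialNorm y < y 0) :
    (fun z : E4 ↦ Real.smoothTransition (E4.spatialNorm z / z 0 - 1)) =ᶠ[𝓝 y]
      fun _ ↦ (0 : ℝ) := by
  have h2 : ∀ᶠ z in 𝓝 y, E4.spatialNorm z < z 0 :=
    continuous_spatialNorm.continuousAt.eventually_lt continuous_apply_zero.continuousAt hin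
  filter_upwards [eventually_pos_apply_zero hy, h2] with z hz hz2
  apply Real.smoothTransition.zero_of_nonpos
  rw [sub_nonpos, div_le_one hz]
  exact hz2.le

/-- The cutoff takes values in `[0, 1]`, so `‖p(x)‖ ≤ 1`. [folklore] -/
theorem norm_cutoff_le_one (z : E4) :
    ‖Real.smoothTransition (E4.spatialNorm z / z 0 - 1)‖ ≤ 1 := by
  rw [Real.norm_eq_abs, abs_of_nonneg (Real.smoothTransition.nonneg _)]
  exact Real.smoothTransition.le_one _

/-- **Compactness bound**: every derivative of the cutoff is bounded on the compact set
`{x⁰ = 1, |x̲| ≤ 2}` (continuity of `Dⁱp` on the open half-space `{x⁰ > 0}`). [folklore] -/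
theorem exists_bound_iteratedFDeriv_cutoff (i : ℕ) :
    ∃ C : ℝ, ∀ z : E4, z 0 = 1 → E4.spatialNorm z ≤ 2 →
      ‖iteratedFDeriv ℝ i (fun z : E4 ↦ Real.smoothTransition (E4.spatialNorm z / z 0 - 1)) z‖ ≤
        C := by
  set p : E4 → ℝ := fun z ↦ Real.smoothTransition (E4.spatialNorm z / z 0 - 1) with hp
  set O : Set E4 := {z | 0 < z 0} with hO
  have hOo : IsOpen O := isOpen_lt continuous_const continuous_apply_zero
  have hcd : ContDiffOn ℝ ∞ p O := fun z hz ↦ (contDiffAt_cutoff hz).contDiffWithinAt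
  have hcont : ContinuousOn (iteratedFDeriv ℝ i p) O := by
    have h1 := hcd.continuousOn_iteratedFDerivWithin (m := i) (by exact_mod_cast le_top)
      hOo.uniqueDiffOn
    exact h1.congr fun z hz ↦ (iteratedFDerivWithin_of_isOpen i hOo hz).symm
  set K : Set E4 := {z | z 0 = 1 ∧ E4.spatialNorm z ≤ 2} with hK
  have hKc : IsCompact K := by
    have hclosed : IsClosed K :=
      (isClosed_eq continuous_apply_zero continuous_const).inter
        (isClosed_le continuous_spatialNorm continuous_const)
    refine Metric.isCompact_of_isClosed_isBounded hclosed ?_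
    refine (Metric.isBounded_closedBall (x := (0 : E4)) (r := 3)).subset ?_
    intro z hz
    rw [Metric.mem_closedBall, dist_zero_right]
    have hsq : ‖z‖ ^ 2 ≤ 9 := by
      rw [norm_sq_eq_sq_add_spatialNorm_sq, hz.1]
      nlinarith [hz.2, E4.spatialNorm_nonneg z]
    nlinarith [norm_nonneg z]
  have hKO : K ⊆ O := fun z hz ↦ by
    show 0 < z 0
    rw [hz.1]
    exact one_pos
  obtain ⟨C, hC⟩ := hKc.exists_bound_of_continuousOn (hcont.mono hKO)
  exact ⟨C, fun z hz0 hz2 ↦ hC z ⟨hz0, hz2⟩⟩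

/-- **Derivative bounds for the cutoff**: there is `A ≥ 1` with `‖Dⁱ p(x)‖ ≤ A / (x⁰)ⁱ` for all
`i ≤ 4` and all `x` with `x⁰ > 0` (scaling to `x⁰ = 1` by the dilation invariance of `p`, then
the compactness bound on `{|x̲| ≤ 2}` and `Dⁱp = 0`, `i ≥ 1`, on `{|x̲| > 2}` where `p ≡ 1`).
[folklore] -/
theorem bentLabDeviation_cutoff_bounds : open Literature.Geometry.Lorentzian in ∃ A : ℝ, 1 ≤ A ∧ ∀ i ≤ 4, ∀ y : E4, 0 < y 0 → ‖iteratedFDeriv ℝ i (fun z : E4 ↦ Real.smoothTransition (E4.spatialNorm z / z 0 - 1)) y‖ ≤ A / y 0 ^ i := by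
  choose C hC using exists_bound_iteratedFDeriv_cutoff
  set p : E4 → ℝ := fun z ↦ Real.smoothTransition (E4.spatialNorm z / z 0 - 1) with hp
  refine ⟨max 1 (∑ j ∈ Finset.range 5, |C j|), le_max_left _ _, fun i hi y hy ↦ ?_⟩
  set A : ℝ := max 1 (∑ j ∈ Finset.range 5, |C j|) with hA
  have hA1 : 1 ≤ A := le_max_left _ _
  have hCi : C i ≤ A :=
    ((le_abs_self _).trans (Finset.single_le_sum (f := fun j ↦ |C j|)
      (fun j _ ↦ abs_nonneg (C j)) (Finset.mem_range.mpr (by omega)))).trans (le_max_right _ _)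
  -- scaling to `x⁰ = 1`
  set ε : ℝ := (y 0)⁻¹ with hε
  have hε0 : 0 < ε := inv_pos.mpr hy
  have hz0 : (ε • y) 0 = 1 := by
    rw [smul_apply_zero, hε, inv_mul_cancel₀ hy.ne']
  have hz0' : 0 < (ε • y) 0 := by
    rw [hz0]
    exact one_pos
  have hfun : p = fun z ↦ (1 : ℝ) • p (ε • z) := by
    funext z
    rw [one_smul, hp]
    exact (cutoff_smul hε0 z).symm
  have hcd : ContDiffAt ℝ i p (ε • y) :=
    (contDiffAt_cutoff (n := i) hz0').of_le le_rfl
  have key := norm_iteratedFDeriv_const_smul_comp_smul_le p 1 hε0.ne' y (m := i) hcd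
  -- the bound at the rescaled point
  have hb : ‖iteratedFDeriv ℝ i p (ε • y)‖ ≤ A := by
    rcases le_or_gt (E4.spatialNorm (ε • y)) 2 with h2 | h2
    · exact (hC i _ hz0 h2).trans hCi
    · rcases Nat.eq_zero_or_pos i with hi0 | hi0
      · subst hi0
        rw [norm_iteratedFDeriv_zero]
        exact (norm_cutoff_le_one _).trans hA1
      · have hev := cutoff_eventuallyEq_one hz0' (by rw [hz0]; linarith)
        rw [(hev.iteratedFDeriv ℝ i).eq_of_nhds, iteratedFDeriv_const_of_ne (by omega)]
        simp only [Pi.zero_apply, norm_zero]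
        exact zero_le_one.trans hA1
  calc ‖iteratedFDeriv ℝ i p y‖ = ‖iteratedFDeriv ℝ i (fun z ↦ (1 : ℝ) • p (ε • z)) y‖ := by
        rw [← hfun]
    _ ≤ |(1 : ℝ)| * |ε| ^ i * ‖iteratedFDeriv ℝ i p (ε • y)‖ := key
    _ ≤ 1 * ε ^ i * A := by
        rw [abs_one, abs_of_pos hε0]
        exact mul_le_mul_of_nonneg_left hb (by positivity)
    _ = A / y 0 ^ i := by
        rw [one_mul, hε, inv_pow, div_eq_inv_mul]

/-! ### The radial height `x ↦ T(|x̲|)` -/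

section Radial

variable {M a : ℝ}

/-- **The radial height is smooth on all of `E4`**: off the time axis it is `T ∘ |·̲|` with both
maps smooth, and near the time axis `|x̲| < 4M` so it vanishes identically. [folklore] -/
theorem contDiffAt_radialHeight (h : |a| < M) (y : E4) {n : ℕ∞} :
    ContDiffAt ℝ n (fun z : E4 ↦ bentHeight M a (E4.spatialNorm z)) y := by
  have hM := mass_pos h
  by_cases h0 : E4.spatialNorm y = 0
  · have hlt : ∀ᶠ z in 𝓝 y, E4.spatialNorm z < 4 * M :=
      continuous_spatialNorm.continuousAt.eventually_lt continuousAt_const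
        (show E4.spatialNorm y < 4 * M by rw [h0]; linarith)
    have hev : (fun z : E4 ↦ bentHeight M a (E4.spatialNorm z)) =ᶠ[𝓝 y] fun _ ↦ (0 : ℝ) := by
      filter_upwards [hlt] with z hz
      exact bentHeight_eq_zero_of_le hM hz.le
    exact (contDiffAt_const (c := (0 : ℝ))).congr_of_eventuallyEq hev
  · exact (contDiff_bentHeight h).contDiffAt.comp y (contDiffAt_spatialNorm h0)

/-- The radial height is `Cⁿ` for every finite-or-`∞` order. [folklore] -/
theorem contDiff_radialHeight (h : |a| < M) {n : ℕ∞} :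
    ContDiff ℝ n (fun z : E4 ↦ bentHeight M a (E4.spatialNorm z)) :=
  contDiff_iff_contDiffAt.2 fun y ↦ contDiffAt_radialHeight h y

/-- `0 ≤ T(|x̲|) ≤ 2M log(|x̲|/M)` for `|x̲| ≥ M`, as a bound on the norm. [folklore] -/
theorem norm_radialHeight_le (h : |a| < M) {y : E4} (hy : M ≤ E4.spatialNorm y) :
    ‖bentHeight M a (E4.spatialNorm y)‖ ≤ 2 * M * Real.log (E4.spatialNorm y / M) := by
  rw [Real.norm_eq_abs, abs_of_nonneg (bentHeight_nonneg h _)]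
  exact bentHeight_le_two_mul_log h hy

/-- Monotone form of the logarithmic bound: for `M ≤ |x̲| ≤ L`, `‖T(|x̲|)‖ ≤ 2M log(L/M)`.
[folklore] -/
theorem norm_radialHeight_le_of_le (h : |a| < M) {y : E4} {L : ℝ} (hy : M ≤ E4.spatialNorm y)
    (hL : E4.spatialNorm y ≤ L) :
    ‖bentHeight M a (E4.spatialNorm y)‖ ≤ 2 * M * Real.log (L / M) := by
  have hM := mass_pos h
  refine (norm_radialHeight_le h hy).trans ?_
  refine mul_le_mul_of_nonneg_left (Real.log_le_log (div_pos (hM.trans_le hy) hM) ?_)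
    (by linarith)
  exact div_le_div_of_nonneg_right hL hM.le

end Radial

end Summit.FinalStateConjecture.FinalStateConjecture.Theorems.BentLabDeviation

end
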